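import Literature.NumberTheory.EllipticCurves.IwasawaSelmerControlLocalInputsProofs
import Literature.NumberTheory.EllipticCurves.SelmerCorankProofs
import Literature.NumberTheory.GaloisRepresentations.AbsGaloisGroupCompact
import Literature.NumberTheory.EllipticCurves.ZpExtensionPadicUnitsProofs
import HarnessLib

/-!
# Continuity of `H¹` down a tower: a class that dies on `⋂ₙ Hₙ` dies on some `Hₙ`; the local
# tower kernel `𝒦_{v,0}` is the UNION of the finite-level kernels (cell `b2b-bsdres`,
# CLASS-CLOSURE lane, class O10 — x1b GEN 35, class lead; file 44 of the series: brick B2 of the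
# GLOBAL count (C), part 1 — the descent of the level-`∞` local conditions to a finite layer)

HONEST FRAMING (cell `b2b-bsdres`, run/shared/lean/b2b/bsd-rank1-residual/, verbatim in every
file): the goal of the cell is to DELETE the COMBINATION-SHAPED residual classes of the
Birch–Swinnerton-Dyer formula for ALL analytic-rank `≤ 1` elliptic curves over `ℚ` — "full BSD
formula for every rank `≤ 1` curve in class `C`" assembled STRICTLY from published theorems — so
that the rank-`≤ 1` remainder becomes exactly the CONSTRUCTION-SHAPED classes, which are TYPED
(missing-input `Prop`s), NOT attempted. This is not "finishing BSD". CLASS-CLOSURE lane: prove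
what is provable now; shrink each hard class to its core with data; no claim beyond stated classes;
research routes on CONSTRUCTION-SHAPED X12 / O10; census / instrument output = EVIDENCE / conjecture
items, NEVER a Literature fact; `RESIDUAL-MAP.md` marks change only by signed lines. THIS FILE:
TOOL THEOREMS ONLY (generic continuous-cohomology bookkeeping over the tree's `subgroupH1` /
`resOfLe` / `localTowerKer`) — no definition, no named Literature fact, no Summits-side fact
`def … : Prop`, no `sorry`, axioms standard; nothing is booked; no label / mark / count / sub-cell
moves; (C1_η), (C2_η-GZ), (C3_η) stay typed as filed; O10 stays OPEN / CONSTRUCTION-SHAPED; nothing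
about `BSD(W, p)` of any pair is claimed.

## What (brick B2 of the GLOBAL count (C), x1b GEN 34 `HSUM-UNCONDITIONAL-x1b.md` §3b)

The count (C) compares `A₀ = h₀⁻¹(S_∞)` (classes over `K` whose restriction to `K_∞` lies in a
Selmer family `S_∞ = ⋃ₙ hₙ(Sₙ)`) with the classes satisfying the LEVEL-`∞` local conditions. The
passage "local condition at `K_{∞,w}` ⟹ local condition at `K_{n,w}` for some finite `n`" is the
continuity of Galois cohomology in the tower, `H¹(K_{∞,w}, ·) = lim→ₙ H¹(K_{n,w}, ·)` on the kernel
side (Serre, *Galois Cohomology*, I.§2.2 Prop. 8; Greenberg, LNM 1716, §3 p. 86, where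
`ker(r_v) = ⋃ₙ ker(H¹(F_v, E) → H¹((F_n)_{v_n}, E))` is used tacitly). This file PROVES it in the
objects of the tree:

* §1 (generic) `exists_resOfLe_eq_zero_of_antitone`: `G` a compact topological group, `M` a
  discrete `G`-module with continuous orbit maps, `H' ≥ H₀ ≥ H₁ ≥ ⋯` closed subgroups and `H_∞`
  a subgroup containing `⋂ₙ Hₙ`… more precisely with `H_∞ ≤ Hₙ` for all `n` and
  `(∀ n, g ∈ Hₙ) → g ∈ H_∞`: if `x ∈ H¹(H', M)` restricts to `0` on `H_∞` then it restricts to `0`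
  on some `Hₙ` — a cocycle representing `x` and vanishing on `H_∞` vanishes on an open
  neighbourhood of `H_∞` in `H'`, which contains some `Hₙ` by compactness (Cantor's intersection
  theorem, Mathlib `IsCompact.nonempty_iInter_of_sequence_nonempty_isCompact_isClosed`);
  `forall_ge` form by transitivity of restriction.
* §2 (the local tower) `exists_forall_resOfLe_localSubgroup_eq_zero_of_mem_localTowerKer_zero`:
  for a `ℤ_p`-extension `κ` of `K`, a `K`-field `E` (a completion) and an elliptic curve `W`, every
  class of the level-`0` local tower kernel
  `𝒦_{E,0} = ker (H¹(Γ_E, E(K̄_E)) → H¹(Gal(K̄_E/K_∞·E), E(K̄_E)))` (`WeierstrassCurve.localTowerKer`)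
  already dies in `H¹(Gal(K̄_E/K_n·E), E(K̄_E))` for all large `n`
  (`⋂ₙ Gal(K̄_E/K_n·E) = Gal(K̄_E/K_∞·E)` from `⋂ₙ κ⁻¹(pⁿℤ_p) = ker κ`); finite-family form
  `exists_forall_forall_resOfLe_localSubgroup_eq_zero` (one `n` for finitely many classes, e.g. the
  localisations of one global class at the finitely many places of a set `S`).

References: [SerreGaloisCohomology1997] J.-P. Serre, *Galois Cohomology*, I.§2.2 Prop. 8;
[GreenbergLNM1716] R. Greenberg, LNM 1716 (1999), §3 pp. 85–87; [Washington1997] §13.1.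
-/

noncomputable section

open scoped Classical

universe u

namespace Summit.BirchSwinnertonDyer.Rank1Residual.Additive

open Literature.NumberTheory.EllipticCurves Literature.NumberTheory.GaloisRepresentations ZpExtension

/-! ## §1 Generic: a class dying on `H_∞ = ⋂ₙ Hₙ` dies on some `Hₙ` -/

section Generic

variable {G : Type u} [Group G] [TopologicalSpace G] [IsTopologicalGroup G] [CompactSpace G]
  {M : Type u} [AddCommGroup M] [DistribMulAction G M] [TopologicalSpace M] [DiscreteTopology M]

/-- **Continuity of `H¹` down a tower (kernel side).** Let `G` be a compact topological group, `M`
a discrete `G`-module with continuous orbit maps, `H' ≤ G`, `(Hₙ)` an antitone sequence of CLOSED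
subgroups of `H'`, and `H_∞ ≤ Hₙ` (all `n`) a subgroup containing every `g` lying in all `Hₙ`.
If `x ∈ H¹(H', M)` restricts to `0` in `H¹(H_∞, M)`, then `x` restricts to `0` in `H¹(Hₙ, M)`
for some `n`. Proof: write `x = [φ]`; `res_{H_∞} x = 0` gives `m` with `φ = ∂m` on `H_∞`;
`φ' = φ − ∂m` is a continuous cocycle in the class `x` vanishing on `H_∞`; its zero set is open
in `H'` (`M` discrete), say `H' ∩ O`; the closed sets `Hₙ \ O` decrease to `∅`, so one of them is
empty by compactness, i.e. `φ'` vanishes on `Hₙ`, whence `res_{Hₙ} x = [φ'|_{Hₙ}] = 0`.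
Serre, *Galois Cohomology*, I.§2.2, Prop. 8 (`H^q(lim← Gᵢ, lim→ Aᵢ) = lim→ H^q(Gᵢ, Aᵢ)`), the
injectivity half for `q = 1` and constant coefficients. [cite: SerreGaloisCohomology1997, I.§2.2 Prop. 8] -/
theorem exists_resOfLe_eq_zero_of_antitone {H' : Subgroup G} (H : ℕ → Subgroup G)
    (hH : Antitone H) (hle : ∀ n, H n ≤ H') (hclosed : ∀ n, IsClosed (H n : Set G))
    {Hinf : Subgroup G} (hinf : ∀ n, Hinf ≤ H n) (hmem : ∀ g : G, (∀ n, g ∈ H n) → g ∈ Hinf)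
    (hcont : ∀ m : M, Continuous fun g : G ↦ g • m)
    {x : subgroupH1 H' M} (hx : resOfLe M ((hinf 0).trans (hle 0)) x = 0) :
    ∃ n : ℕ, resOfLe M (hle n) x = 0 := by
  have h0 : Hinf ≤ H' := (hinf 0).trans (hle 0)
  obtain ⟨φ, rfl⟩ := oneCocycleClass_surjective _ x
  -- `res_{H_∞} [φ] = 0`: `φ = ∂m` on `H_∞`
  have hres : oneCocycleClass _ (contOneCocycles.pullback (subgroupInclusion h0)
      (resHomOfEquivariant (subgroupInclusion h0) (AddMonoidHom.id M) (fun _ _ ↦ rfl)) φ) = 0 := by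
    rw [← map_oneCocycleClass]; exact hx
  rw [oneCocycleClass_eq_zero_iff] at hres
  obtain ⟨m, hm⟩ := hres
  -- `φ' = φ − ∂m` vanishes on `H_∞`
  have hcont' : Continuous fun g : H' ↦ g • m := (hcont m).comp continuous_subtype_val
  set φ' := φ - cobCocycle m hcont' with hφ'
  have hφ'van : ∀ (g : G) (hg : g ∈ Hinf), φ'.1 ⟨g, h0 hg⟩ = 0 := by
    intro g hg
    have h : φ.1 ⟨g, h0 hg⟩ = (⟨g, hg⟩ : Hinf) • m - m := hm ⟨g, hg⟩
    rw [hφ', Submodule.coe_sub, ContinuousMap.sub_apply, cobCocycle_apply, sub_eq_zero]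
    exact h
  have hcls : oneCocycleClass _ φ = oneCocycleClass _ φ' := by
    rw [hφ', oneCocycleClass_sub, oneCocycleClass_cobCocycle, sub_zero]
  -- the zero set of `φ'` is open in `H'`: `H' ∩ O`
  have hZ : IsOpen ((fun g : H' ↦ φ'.1 g) ⁻¹' {0}) :=
    (isOpen_discrete _).preimage φ'.1.continuous
  obtain ⟨O, hO, hOZ⟩ := isOpen_induced_iff.mp hZ
  have hmemO : ∀ g : H', (g : G) ∈ O ↔ φ'.1 g = 0 := fun g ↦ by
    have := congrArg (fun s : Set H' ↦ g ∈ s) hOZ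
    simpa using this
  -- the closed sets `C n = Hₙ \ O` decrease to `∅`
  set C : ℕ → Set G := fun n ↦ (H n : Set G) ∩ Oᶜ with hC
  have hCanti : ∀ n, C (n + 1) ⊆ C n := fun n ↦
    Set.inter_subset_inter_left _ (by exact_mod_cast hH (Nat.le_succ n))
  have hCcl : ∀ n, IsClosed (C n) := fun n ↦ (hclosed n).inter hO.isClosed_compl
  have hC0 : IsCompact (C 0) := (hCcl 0).isCompact
  have hempty : (⋂ n, C n) = ∅ := by
    ext g
    simp only [Set.mem_iInter, Set.mem_empty_iff_false, iff_false]
    intro hg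
    have hgH : ∀ n, g ∈ H n := fun n ↦ (hg n).1
    have hginf : g ∈ Hinf := hmem g hgH
    have hgO : g ∈ O := (hmemO ⟨g, h0 hginf⟩).mpr (hφ'van g hginf)
    exact (hg 0).2 hgO
  -- hence some `C n` is empty
  have hex : ∃ n, C n = ∅ := by
    by_contra hne
    have hne' : ∀ n, (C n).Nonempty := fun n ↦
      Set.nonempty_iff_ne_empty.mpr fun h ↦ hne ⟨n, h⟩
    obtain ⟨g, hg⟩ :=
      IsCompact.nonempty_iInter_of_sequence_nonempty_isCompact_isClosed C hCanti hne' hC0 hCcl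
    rw [hempty] at hg
    exact hg
  obtain ⟨n, hn⟩ := hex
  -- `φ'` vanishes on `Hₙ`
  have hvan : ∀ g : H n, φ'.1 ⟨(g : G), hle n g.2⟩ = 0 := by
    intro g
    by_contra hg
    have hgO : (g : G) ∉ O := fun h ↦ hg ((hmemO ⟨(g : G), hle n g.2⟩).mp h)
    have : (g : G) ∈ C n := ⟨g.2, hgO⟩
    rw [hn] at this
    exact this
  refine ⟨n, ?_⟩
  rw [hcls]
  have hfin : oneCocycleClass _ (contOneCocycles.pullback (subgroupInclusion (hle n))
      (resHomOfEquivariant (subgroupInclusion (hle n)) (AddMonoidHom.id M) (fun _ _ ↦ rfl)) φ') =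
      0 := by
    rw [oneCocycleClass_eq_zero_iff]
    exact ⟨0, fun g ↦ by rw [map_zero, sub_zero]; exact hvan g⟩
  rw [← map_oneCocycleClass] at hfin
  exact hfin

/-- **The `forall_ge` form**: under the hypotheses of `exists_resOfLe_eq_zero_of_antitone`, `x`
restricts to `0` in `H¹(Hₘ, M)` for ALL `m ≥ n` (restriction `H' → Hₘ` factors through `Hₙ`,
`resOfLe_comp`). [cite: SerreGaloisCohomology1997, I.§2.2 Prop. 8] -/
theorem exists_forall_resOfLe_eq_zero_of_antitone {H' : Subgroup G} (H : ℕ → Subgroup G)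
    (hH : Antitone H) (hle : ∀ n, H n ≤ H') (hclosed : ∀ n, IsClosed (H n : Set G))
    {Hinf : Subgroup G} (hinf : ∀ n, Hinf ≤ H n) (hmem : ∀ g : G, (∀ n, g ∈ H n) → g ∈ Hinf)
    (hcont : ∀ m : M, Continuous fun g : G ↦ g • m)
    {x : subgroupH1 H' M} (hx : resOfLe M ((hinf 0).trans (hle 0)) x = 0) :
    ∃ n : ℕ, ∀ m, n ≤ m → resOfLe M (hle m) x = 0 := by
  obtain ⟨n, hn⟩ := exists_resOfLe_eq_zero_of_antitone H hH hle hclosed hinf hmem hcont hx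
  refine ⟨n, fun m hnm ↦ ?_⟩
  have hcomp := congrArg (fun f ↦ f x) (resOfLe_comp_holds (M := M) (hH hnm) (hle n))
  simp only [AddMonoidHom.coe_comp, Function.comp_apply] at hcomp
  rw [← hcomp, hn, map_zero]

end Generic

/-! ## §2 The local tower: `𝒦_{E,0} = ⋃ₙ ker (H¹(Γ_E, E(K̄_E)) → H¹(Gal(K̄_E/K_n·E), E(K̄_E)))` -/

section Tower

variable {K : Type u} [Field K] (W : WeierstrassCurve K) {p : ℕ} [Fact p.Prime]
  (κ : ZpExtension K p) (E : Type u) [Field E] [Algebra K E]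

/-- `⋂ₙ κ⁻¹(pⁿ ℤ_p) = ker κ`: an element of every layer subgroup lies in `Gal(K̄/K_∞)`
(`K_∞ = ⋃ₙ K_n`; `⋂ₙ pⁿℤ_p = 0`). [cite: Washington1997, §13.1] -/
theorem mem_kerSubgroup_of_forall_mem_layerSubgroup' {σ : Field.absoluteGaloisGroup K}
    (h : ∀ n : ℕ, σ ∈ κ.layerSubgroup n) : σ ∈ κ.kerSubgroup := by
  rw [ZpExtension.mem_kerSubgroup]
  have h0 : (κ σ).toAdd = 0 :=
    ZpExtension.PadicUnits.eq_zero_of_forall_pow_dvd fun n ↦ ZpExtension.mem_layerSubgroup.mp (h n)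
  exact toAdd_eq_zero.mp h0

/-- `⋂ₙ Gal(K̄_E/K_n·E) = Gal(K̄_E/K_∞·E)`: the local subgroups of the layers cut out the local
subgroup of `ker κ`. [cite: Washington1997, §13.1] -/
theorem mem_localSubgroup_kerSubgroup_of_forall {τ : Field.absoluteGaloisGroup E}
    (h : ∀ n : ℕ, τ ∈ localSubgroup (κ.layerSubgroup n) E) :
    τ ∈ localSubgroup κ.kerSubgroup E :=
  (mem_localSubgroup_iff _ _ τ).mpr
    (mem_kerSubgroup_of_forall_mem_layerSubgroup' κ fun n ↦ (mem_localSubgroup_iff _ _ τ).mp (h n))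

/-- The local layer subgroups `Gal(K̄_E/K_n·E) = (Γ_E → Γ_K)⁻¹(κ⁻¹(pⁿℤ_p))` are closed (preimages
of the open, hence closed, subgroups `κ⁻¹(pⁿℤ_p)` under the continuous restriction).
[cite: Washington1997, §13.1] -/
theorem isClosed_localSubgroup_layerSubgroup (n : ℕ) :
    IsClosed (localSubgroup (κ.layerSubgroup n) E : Set (Field.absoluteGaloisGroup E)) := by
  have h : IsClosed (κ.layerSubgroup n : Set (Field.absoluteGaloisGroup K)) :=
    Subgroup.isClosed_of_isOpen _ (κ.isOpen_layerSubgroup n)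
  exact h.preimage (map_continuous (resGal (K := K) E))

/-- **`𝒦_{E,0} = ⋃ₙ 𝒦_{E,0→n}`: a class of the level-`0` local tower kernel dies at a finite
layer.** For a `ℤ_p`-extension `κ` of `K`, a `K`-field `E` and an elliptic curve (Weierstrass
model) `W/K`: if `x ∈ H¹(Gal(K̄_E/K_0·E), E(K̄_E))` (`K_0 = K`) restricts to `0` on
`Gal(K̄_E/K_∞·E)` — `x ∈ 𝒦_{E,0}` (`WeierstrassCurve.localTowerKer κ E 0`) — then there is `n`
such that `x` restricts to `0` on `Gal(K̄_E/K_m·E)` for every `m ≥ n`. (Greenberg's `ker(r_v)` at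
`v`, LNM 1716 §3 p. 86, is this union of finite-level kernels; Serre I.§2.2 Prop. 8.)
[cite: GreenbergLNM1716, §3 p. 86] [cite: SerreGaloisCohomology1997, I.§2.2 Prop. 8] -/
theorem exists_forall_resOfLe_localSubgroup_eq_zero_of_mem_localTowerKer_zero
    {x : discreteH1 (localSubgroup (κ.layerSubgroup 0) E) (localPoints W E)}
    (hx : x ∈ W.localTowerKer κ E 0) :
    ∃ n : ℕ, ∀ m, n ≤ m →
      Literature.NumberTheory.EllipticCurves.resOfLe (localPoints W E)
        (Subgroup.comap_mono (κ.layerSubgroup_antitone (Nat.zero_le m)) :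
          localSubgroup (κ.layerSubgroup m) E ≤ localSubgroup (κ.layerSubgroup 0) E) x = 0 := by
  haveI : CompactSpace (Field.absoluteGaloisGroup E) := absoluteGaloisGroup_compactSpace E
  exact exists_forall_resOfLe_eq_zero_of_antitone
    (fun n ↦ localSubgroup (κ.layerSubgroup n) E)
    (fun _ _ h ↦ Subgroup.comap_mono (κ.layerSubgroup_antitone h))
    (fun m ↦ Subgroup.comap_mono (κ.layerSubgroup_antitone (Nat.zero_le m)))
    (isClosed_localSubgroup_layerSubgroup κ E)
    (hinf := fun n ↦ WeierstrassCurve.localSubgroup_ker_le_layer κ E n)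
    (fun τ hτ ↦ mem_localSubgroup_kerSubgroup_of_forall κ E hτ)
    (continuous_smul_localPoints W E) hx

/-- **One layer for finitely many classes.** For a finite family `(x_i)_{i ∈ I}` of classes of the
level-`0` local tower kernels at `K`-fields `E_i` (e.g. the localisations of one global class at
the places of a finite set `S`), there is ONE `n` such that every `x_i` dies on `Gal(K̄_{E_i}/K_m·E_i)`
for all `m ≥ n` (take the maximum). [cite: GreenbergLNM1716, §3 p. 86 and p. 90] -/
theorem exists_forall_forall_resOfLe_localSubgroup_eq_zero {I : Type*} [Finite I]
    (F : I → Type u) [∀ i, Field (F i)] [∀ i, Algebra K (F i)]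
    (x : ∀ i, discreteH1 (localSubgroup (κ.layerSubgroup 0) (F i)) (localPoints W (F i)))
    (hx : ∀ i, x i ∈ W.localTowerKer κ (F i) 0) :
    ∃ n : ℕ, ∀ i, ∀ m, n ≤ m →
      Literature.NumberTheory.EllipticCurves.resOfLe (localPoints W (F i))
        (Subgroup.comap_mono (κ.layerSubgroup_antitone (Nat.zero_le m)) :
          localSubgroup (κ.layerSubgroup m) (F i) ≤ localSubgroup (κ.layerSubgroup 0) (F i)) (x i) = 0 := by
  choose n hn using fun i ↦
    exists_forall_resOfLe_localSubgroup_eq_zero_of_mem_localTowerKer_zero W κ (F i) (hx i)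
  haveI := Fintype.ofFinite I
  refine ⟨Finset.univ.sup n, fun i m hm ↦ hn i m ((Finset.le_sup (Finset.mem_univ i)).trans hm)⟩

end Tower

end Summit.BirchSwinnertonDyer.Rank1Residual.Additive

end
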